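import Literature.AnabelianGeometry.SemiGraphs.ArithThm54CharCoresOfDesignData
import Literature.AnabelianGeometry.SemiGraphs.ArithLevelKerCongruenceChart
import Literature.AnabelianGeometry.SemiGraphs.ArithBranchPairAugChartModKernel
import Literature.AnabelianGeometry.SemiGraphs.ArithLevelKernelInner
import Literature.AnabelianGeometry.SemiGraphs.ArithLevelKernelBaseAction
import Literature.AnabelianGeometry.SemiGraphs.ArithLevelCofinalityOuterAction
import Literature.AnabelianGeometry.SemiGraphs.ArithVertGpCompact
import HarnessLib

/-!
# [SemiAnbd] Thm 5.4 (i) ∧ (ii) AT `π₁^temp(𝒢) ⋊^out Π_A` OF THE CHARACTERISTIC GALOIS TOWER — CAPSTONE v4: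
# (AI4″) `stabBranchPairAug` PRODUCED, the continuity binder `hK1′` REDUCED to `hself` + congruence-continuity

Mochizuki, *Semi-graphs of anabelioids*, Publ. RIMS **42** (2006) 221–322, §5 Thm 5.4 (i)(ii), manuscript p. 66
(l. 50: "the proofs are entirely parallel to those of Theorem 3.7, Corollary 3.9"); Rmk 5.3.1 p. 65; Def 5.1 (i)
p. 62; Prop 5.2 (i)/(iv) pp. 63–64; Prop 3.6 p. 38 [cite: MochizukiSemiAnbd2006, Thm 5.4 (i), p. 66].

PROOF-ONLY file (abc-iut cell, layer L3, producer row T54-B = `plan/GAP-LEDGER.md` G-w4d053-1; seat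
abc-iut-w4-d029 gen 5, row «T54·CAPSTONE-v4@char-tower»).  No definition, no new named fact, no producer
restated — every input is consumed BY NAME:

* `arithMaximalCompactStatement_outerAction_piPresentation_chart_of_designData_of_congruenceContinuous` — at
  the chart `D.chart …` of ANY cofinal Galois tower `D` with characteristic finite levels (`hker`) and (I0v)
  (`hfaithV`), in abc-iut-w6-d070's tempered level topology `arithLevelTopology` (pinned by `hinst`):
  abc-iut-w4-d089's `…_chart_of_producers_levelTopology` (ArithThm54CapstonesChartLevelTopology.lean p437233,
  over this lineage's `…_chart_of_producers` p436631) with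
  - (AI4″) `stabBranchPairAug :=` abc-iut-w4-d059's hcof-free producer
    `stabBranchPairAug_chart_outerAction_modKernel` (ArithBranchPairAugChartModKernel.lean p442253), whose inputs
    are bound here: `haugc := continuous_outerSemidirectProductSnd`, `hLopen := isOpen_ker_arithAct_of_le`
    (abc-iut-w6-d070, ArithTemperedGroupLevelTopology.lean), `hVc := hVc_of_cosetTower` (abc-iut-w4-d059,
    ArithVertGpCompact.lean; [SemiAnbd] Rmk 5.3.1), `hUclosed := isClosed_map_ker_arithAct_arithLevelTopology`
    and `hU := hU_arithVertGp_of_iInf_map_ker_le ∘ iInf_map_ker_le_of_le_ker_rho ∘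
    mem_ker_of_mem_iInf_map_ker_arithAct_outerAction` (abc-iut-w4-d085: ArithLevelCofinalityOuterAction.lean,
    ArithLevelKernelBaseAction.lean, ArithLevelKernelInner.lean Corollary D p441537 — «hUρ» from the two tower
    inputs `hR`, `hnobp`), `hnobpNCpt := hnobpNCpt_cosetTower_of_faithV_chart … hfaithV` (abc-iut-w4-d053);
  - `hK1′ :=` abc-iut-w4-d089's `GaloisLevelData.hK1'_chart_of_eventually_congruenceContinuous_of_hself`
    (ArithLevelKerCongruenceChart.lean p440870; abc-iut-w6-d117's reduction): beyond a depth `n₀` the vertex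
    images are self-normalising in the tree-level quotients (`hself`) and the outer action is congruence-continuous
    with trivial base action near `1` (`hCC`, Def 5.1 (i)(c)/(d)).
* `arithMaximalCompactStatement_outerAction_piPresentation_charCores_of_designData_of_congruenceContinuous` —
  **CAPSTONE v4**: the previous theorem INSTANTIATED at abc-iut-w4-d048's characteristic tower
  `GaloisLevelData.ofCharCores h36 v₀ hVt hEt` (`d := id`, `hker := ofCharCores_ker_piLevelAut_eq_charOpenCore`
  p440359, `hfaithV := faithfulV_ofCharCores` p437588, tower inputs p437861) = the theorem of record
  `…_charCores_of_designData` (ArithThm54CharCoresOfDesignData.lean p440359) with `stabBranchPairAug` GONE and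
  `hK1′` replaced by `n₀`/`hself`/`hCC`.

HONEST RESIDUAL of CAPSTONE v4 (explicit binders; owners): design data `hV`, `hE`, `hopen`, `hBR` (Prop 3.6 (iv)
at `ρ_𝔾(a)` / Def 5.1 (i)(c); abc-iut-w4-d082's currency; jointly inhabited at the trivial action, abc-iut-w6-d099
p433299); `hRcV`/`hRcB` (the §3 representatives are those read off the presentation — abc-iut-w4-d059); `n₀`,
`hself` (a THEOREM at the canonical tower `𝒢.galoisLevelData h36`, abc-iut-w6-d117
`exists_forall_piPresentation_hself` p442124; its characteristic-tower twin is OWED — abc-iut-w6-d117 /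
this lineage) and `hCC` (Def 5.1 (i)(c)/(d) congruence-continuity at the deep tree levels — DESIGN); the topology
pin `hinst` (`rfl` at consumers); Thm 5.4's printed frame `noSwitchBase`; the two tower inputs of abc-iut-w4-d085's
«hUρ»: `hR` (residual finiteness of `π₁^temp(𝒢)` along the characteristic finite levels, [SemiAnbd] Prop 3.6
(iii); abc-iut-w4-d085, L3-lead α97 «char-tower hR/hnobp») and `hnobp` (the compact-subgroup estrangement test at
the finite levels ⟸ `hnobpNCpt` at one compatible branch-pair system; abc-iut-w4-d085) — «hUρ» is FALSE at a
one-vertex edgeless `𝒢` with `ρ′ ≠ 1` (abc-iut-w4-d071 p441067), where `hnobp` fails; Thm 5.4's OWN hypotheses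
`hest` (total arithmetic estrangement; FALSE at split actions — abc-iut-w6-d072 p433406) and `hbot`; the §5 frame
`[CompactSpace Π_A] [TotallyDisconnectedSpace Π_A]`; Def 5.1 (i) coherence `[Finite Vertex] [Finite Branch]
[Finite Edge]`, `hVt`, `hEt`; base vertex `v₀`; the Thm 3.7 hypotheses `h37` and `hG`.  GONE relative to
p440359: `stabBranchPairAug` (produced), `hK1′` (reduced); no `[T2Space Π_A]` binder (profinite ⇒ Hausdorff,
derived inside).  Nothing beyond composition is proved here; typed ≠ proved for the residual inputs; this is
Thm 5.4 for OUR tower decomposition; no side taken on [IUTchIII] Cor. 3.12.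
-/

namespace Literature.AnabelianGeometry.SemiGraphs

namespace ProfiniteSemiGraph

open CategoryTheory CategoryTheory.PreGaloisCategory Topology Filter Literature.AnabelianGeometry.Anabelioids
open Literature.AnabelianGeometry.EtaleTheta
open Literature.AnabelianGeometry.AbsoluteAnabelian (IsTopologicallyFinitelyGenerated)
open scoped Pointwise FintypeCatDiscrete

universe u

variable {𝒢 : ProfiniteSemiGraph.{u}}

section Chart

variable (D : GaloisLevelData 𝒢) (h𝒢 : 𝒢.IsCountable)
  (hcof : ∀ (T : CovObj 𝒢), T.IsTempered → ∀ p : T.Point,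
    ∃ i : ℕ, ∀ j, i ≤ j → (D.S j).Splits (T.component p))
  (hcn : 𝒢.graph.IsConnected) (hS : ∀ n, (D.S n).Splits (D.S n)) (hfin : ∀ n, (D.S n).IsFinite)
  (hne : ∀ n, (D.S n).HasNonemptyFibres)
  (hconn : ∀ (n : ℕ) (p q : (D.S n).Point), (D.S n).SameComponent p q)

/-- **[SemiAnbd] Thm 5.4 (i) ∧ (ii) at `π₁^temp(𝒢) ⋊^out Π_A` for the chart of a cofinal Galois tower with
characteristic levels, level topology pinned — (AI4″) `stabBranchPairAug` PRODUCED and `hK1′` REDUCED**: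
abc-iut-w4-d089's `…_chart_of_producers_levelTopology` (p437233, over this lineage's `…_chart_of_producers`)
with `stabBranchPairAug :=` abc-iut-w4-d059's `stabBranchPairAug_chart_outerAction_modKernel` (its inputs
`haugc`/`hLopen` from abc-iut-w6-d070's level topology, `hVc` from abc-iut-w4-d059's `hVc_of_cosetTower`,
`hUclosed` from abc-iut-w4-d085, `hU` from abc-iut-w4-d085's Corollary D
`mem_ker_of_mem_iInf_map_ker_arithAct_outerAction` ∘ `iInf_map_ker_le_of_le_ker_rho` ∘
`hU_arithVertGp_of_iInf_map_ker_le`, `hnobpNCpt` from abc-iut-w4-d053 ∘ (I0v)) and `hK1′ :=`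
abc-iut-w4-d089's `hK1'_chart_of_eventually_congruenceContinuous_of_hself` (abc-iut-w6-d117's reduction).
Residual: design data `hV hE hopen hBR`, `hRcV`/`hRcB`, `hker`, `hfaithV`, `n₀`/`hself`/`hCC`, `hinst`,
`noSwitchBase`, `hR`, `hnobp`, `hest`, `hbot`. [cite: MochizukiSemiAnbd2006, Thm 5.4 (i), p. 66] -/
theorem arithMaximalCompactStatement_outerAction_piPresentation_chart_of_designData_of_congruenceContinuous
    (h37 : 𝒢.Thm37Hypotheses) (hG : 𝒢.graph.IsGraph) [Finite 𝒢.graph.Vertex] [Finite 𝒢.graph.Branch]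
    [Finite 𝒢.graph.Edge]
    {PA : Type u} [Group PA] [TopologicalSpace PA] [IsTopologicalGroup PA] [CompactSpace PA]
    [TotallyDisconnectedSpace PA]
    (ρ' : PA →* TopOut (D.chart h𝒢 hcof hcn hS hfin hne).G) (baseAct : PA →* Aut 𝒢.graph)
    [inst : TopologicalSpace (outerSemidirectProduct ρ')]
    (T : ∀ w : 𝒢.graph.Vertex, D.PointSeq h𝒢 w) (R : SemiGraph.RefBranches 𝒢.graph)
    -- §3 representatives MATCHED to the presentation (abc-iut-w4-d059's `hRcV`/`hRcB`)
    (Rc : ChartRepresentatives (D.chart h𝒢 hcof hcn hS hfin hne))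
    (hRcV : ∀ v, Rc.Hv v = (D.piPresentation h𝒢 T R).H v)
    (hRcB : ∀ b, Rc.Hb b = ((D.piPresentation h𝒢 T R).M (𝒢.graph.edgeOf b)).map
      (MulAut.conj ((D.piPresentation h𝒢 T R).s b)).toMonoidHom)
    -- Prop 3.6 (iv) at `ρ_𝔾(a)` / Def 5.1 (i)(c): the DESIGN data of the outer model (abc-iut-w4-d082's currency)
    (hV : ∀ (a : PA) (v : 𝒢.graph.Vertex) (H : Subgroup (D.chart h𝒢 hcof hcn hS hfin hne).G), H ∈ verticialSubgroups (D.chart h𝒢 hcof hcn hS hfin hne) v →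
      ∃ φ : contMulAut (D.chart h𝒢 hcof hcn hS hfin hne).G, TopOut.mk _ φ = ρ' a ∧
        H.map (φ : MulAut (D.chart h𝒢 hcof hcn hS hfin hne).G).toMonoidHom ∈ verticialSubgroups (D.chart h𝒢 hcof hcn hS hfin hne) ((baseAct a).hom.vertexMap v))
    (hE : ∀ (a : PA) (e : 𝒢.graph.Edge) (K : Subgroup (D.chart h𝒢 hcof hcn hS hfin hne).G), K ∈ edgeLikeSubgroups (D.chart h𝒢 hcof hcn hS hfin hne) e →
      ∃ φ : contMulAut (D.chart h𝒢 hcof hcn hS hfin hne).G, TopOut.mk _ φ = ρ' a ∧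
        K.map (φ : MulAut (D.chart h𝒢 hcof hcn hS hfin hne).G).toMonoidHom ∈ edgeLikeSubgroups (D.chart h𝒢 hcof hcn hS hfin hne) ((baseAct a).hom.edgeMap e))
    (hopen : ∃ U : Subgroup PA, IsOpen (U : Set PA) ∧ ∀ a ∈ U,
      (∀ v, (baseAct a).hom.vertexMap v = v) ∧ (∀ e, (baseAct a).hom.edgeMap e = e) ∧
        ∀ b, (baseAct a).hom.branchMap b = b)
    (hBR : ∀ (a : PA) (b : 𝒢.graph.Branch) (v : 𝒢.graph.Vertex) (hb : 𝒢.graph.abuts b = some v)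
      (φ : 𝒢.Gv v →ₜ* (D.chart h𝒢 hcof hcn hS hfin hne).G), IsVerticialHom (D.chart h𝒢 hcof hcn hS hfin hne) v φ →
      ∃ Φ : contMulAut (D.chart h𝒢 hcof hcn hS hfin hne).G, TopOut.mk _ Φ = ρ' a ∧
        ∃ φ' : 𝒢.Gv ((baseAct a).hom.vertexMap v) →ₜ* (D.chart h𝒢 hcof hcn hS hfin hne).G,
          IsVerticialHom (D.chart h𝒢 hcof hcn hS hfin hne) ((baseAct a).hom.vertexMap v) φ' ∧
          ∃ x' : (D.chart h𝒢 hcof hcn hS hfin hne).G,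
            Subgroup.map (Φ : MulAut (D.chart h𝒢 hcof hcn hS hfin hne).G).toMonoidHom φ.toMonoidHom.range =
              Subgroup.map (MulAut.conj x').toMonoidHom φ'.toMonoidHom.range ∧
            Subgroup.map (Φ : MulAut (D.chart h𝒢 hcof hcn hS hfin hne).G).toMonoidHom
                (Subgroup.map φ.toMonoidHom (𝒢.branchSubgroup b v hb)) =
              Subgroup.map (MulAut.conj x').toMonoidHom
                (Subgroup.map φ'.toMonoidHom
                  (𝒢.branchSubgroup ((baseAct a).hom.branchMap b) ((baseAct a).hom.vertexMap v)
                    ((baseAct a).hom.abuts_branchMap b v hb))))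
    (w₀ : 𝒢.graph.Vertex)
    -- CHARACTERISTIC finite levels (abc-iut-L3-t9 E1): `ker π_n` is the characteristic open core of level `d n`
    (d : ℕ → ℕ) (hker : ∀ n, (D.piLevelAut h𝒢 hconn n).ker = charOpenCore (D.temperedPi h𝒢) (d n))
    -- (I0v) for the tower `D` (abc-iut-w4-d053)
    (hfaithV : ∀ (v : 𝒢.graph.Vertex) (h : 𝒢.Gv v),
      (∀ (n : ℕ) (x : ((D.S n).SV v).obj.V), ((D.S n).SV v).obj.ρ h x = x) → h = 1)
    -- the reduction of the continuity binder `hK1′` (abc-iut-w6-d117 / abc-iut-w4-d089 p440870): beyond depth `n₀`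
    -- the vertex images are SELF-NORMALISING in the tree-level quotients (`hself`; a THEOREM at the canonical
    -- tower, abc-iut-w6-d117 p442124) and the outer action is CONGRUENCE-CONTINUOUS with trivial base action
    -- near `1` (`hCC`, Def 5.1 (i)(c)/(d) — DESIGN)
    (n₀ : ℕ)
    (hself : ∀ n, n₀ ≤ n → ∀ (w : 𝒢.graph.Vertex)
      (q : (D.chart h𝒢 hcof hcn hS hfin hne).G ⧸ (D.projAut h𝒢 n).ker),
      (∀ x : (D.chart h𝒢 hcof hcn hS hfin hne).G ⧸ (D.projAut h𝒢 n).ker,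
        x ∈ ((D.piPresentation h𝒢 T R).H w).map (QuotientGroup.mk' _) ↔
        q⁻¹ * x * q ∈ ((D.piPresentation h𝒢 T R).H w).map (QuotientGroup.mk' _)) →
      q ∈ ((D.piPresentation h𝒢 T R).H w).map (QuotientGroup.mk' _))
    (hCC : ∀ n, n₀ ≤ n → ∃ U ∈ 𝓝 (1 : PA), ∀ a ∈ U, baseAct a = 1 ∧
      ∃ φ : contMulAut (D.chart h𝒢 hcof hcn hS hfin hne).G, TopOut.mk (D.chart h𝒢 hcof hcn hS hfin hne).G φ = ρ' a ∧
        ∀ y : (D.chart h𝒢 hcof hcn hS hfin hne).G, (φ : MulAut (D.chart h𝒢 hcof hcn hS hfin hne).G) y * y⁻¹ ∈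
          (D.projAut h𝒢 n).ker)
    -- the topology of `E` IS abc-iut-w6-d070's tempered level topology at the chart of the tower (`hK1′` := the
    -- term derived from `hself`/`hCC`)
    (hinst : inst = @arithLevelTopology 𝒢 (D.chart h𝒢 hcof hcn hS hfin hne) PA _ _ _ ρ' baseAct
        (TemperedPiChart.firstCountableTopology_G (D.chart h𝒢 hcof hcn hS hfin hne)) h37.toProp36Hypotheses IsTempered.of_profinite (D.piPresentation h𝒢 T R)
        (isArithCompatible_piPresentation_outerAction_of_branchPair_chart_of_finite D h𝒢 hcof hcn hS hfin hne T R ρ' baseAct h37 hG hV hBR) w₀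
        (D.isCompact_piPresentation_H h𝒢 T R w₀) (fun n => (D.projAut h𝒢 n).ker) (fun _ => MonoidHom.normal_ker _)
        (D.hKst_and_hLst_of_ker_piLevelAut_eq_charOpenCore h𝒢 hconn T R ρ' (isArithCompatible_piPresentation_outerAction_of_branchPair_chart_of_finite D h𝒢 hcof hcn hS hfin hne T R ρ' baseAct h37 hG hV hBR) d hker).1
        (D.ker_projAut_anti h𝒢) (D.isOpen_ker_projAut h𝒢) (fun _ hU => D.exists_ker_projAut_subset h𝒢 hU) (D.hK1'_chart_of_eventually_congruenceContinuous_of_hself h𝒢 hcof hcn hS hfin hne hconn ρ' baseAct T R (isArithCompatible_piPresentation_outerAction_of_branchPair_chart_of_finite D h𝒢 hcof hcn hS hfin hne T R ρ' baseAct h37 hG hV hBR) d hker hG n₀ hself hCC))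
    (noSwitchBase : NoBranchSwitching 𝒢.graph.edgeOf
      (fun (a : PA) (b : 𝒢.graph.Branch) => (baseAct a).hom.branchMap b))
    -- the two tower inputs of abc-iut-w4-d085's "hUρ" (ArithLevelKernelInner, Corollary D): RESIDUAL FINITENESS
    -- of `π₁^temp(𝒢)` along the finite levels ([SemiAnbd] Prop 3.6 (iii)) and the compact-subgroup test (estrangement)
    (hR : ∀ g : (D.chart h𝒢 hcof hcn hS hfin hne).G, (∀ n, g ∈ (D.piLevelAut h𝒢 hconn n).ker) → g = 1)
    (hnobp : ∀ C : Subgroup (D.chart h𝒢 hcof hcn hS hfin hne).G, IsCompact (C : Set (D.chart h𝒢 hcof hcn hS hfin hne).G) →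
      (∀ n (t : C), (D.piPresentation h𝒢 T R).deckAct (D.piLevelAut h𝒢 hconn n).ker (t : (D.chart h𝒢 hcof hcn hS hfin hne).G) = 1) → C = ⊥)
    (hest : IsTotallyArithEstranged (decompositionDataOfChart Rc (toOuterSemidirectProduct ρ')) (outerSemidirectProductSnd ρ')) (hbot : ¬ IsArithAmple (outerSemidirectProductSnd ρ') ⊥) :
    ArithMaximalCompactStatementI (decompositionDataOfChart Rc (toOuterSemidirectProduct ρ')) (outerSemidirectProductSnd ρ') ∧
      ArithMaximalCompactStatementII (decompositionDataOfChart Rc (toOuterSemidirectProduct ρ')) (outerSemidirectProductSnd ρ') := by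
  subst hinst
  -- exactness of `1 → π₁^temp → E → Π_A → 1` (temp-slimness) at the chart of the tower; the inner action
  obtain ⟨hι, hex, -⟩ := outerAction_exact (D.chart h𝒢 hcof hcn hS hfin hne) ρ' h37.toProp36Hypotheses
  have hιΦ : ∀ g : (D.chart h𝒢 hcof hcn hS hfin hne).G, (((contMulAut (D.chart h𝒢 hcof hcn hS hfin hne).G).subtype.comp (MonoidHom.fst (contMulAut (D.chart h𝒢 hcof hcn hS hfin hne).G) PA)).comp (outerSemidirectProduct ρ').subtype) ((toOuterSemidirectProduct ρ') g) = MulAut.conj g := fun _ => rfl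
  have hισ : ∀ g : (D.chart h𝒢 hcof hcn hS hfin hne).G, (baseAct.comp (outerSemidirectProductSnd ρ')) ((toOuterSemidirectProduct ρ') g) = 1 := fun g => by
    have hg : (toOuterSemidirectProduct ρ') g ∈ (outerSemidirectProductSnd ρ').ker := hex ▸ ⟨g, rfl⟩
    rw [MonoidHom.comp_apply, (MonoidHom.mem_ker).mp hg, map_one]
  have hPH : ∀ w, (D.piPresentation h𝒢 T R).H w ∈ verticialSubgroups (D.chart h𝒢 hcof hcn hS hfin hne) w := fun w => by
    rw [D.piPresentation_H h𝒢 T R]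
    exact (T w).range_decompHom_mem_verticialSubgroups_chart hcof hcn hS hfin hne
  have hHc := fun w => D.isCompact_piPresentation_H h𝒢 T R w
  haveI hNn : ∀ n : ℕ, @Subgroup.Normal (D.chart h𝒢 hcof hcn hS hfin hne).G (D.chart h𝒢 hcof hcn hS hfin hne).group ((D.projAut h𝒢 n).ker) :=
    fun _ => MonoidHom.normal_ker _
  haveI hLn : ∀ n : ℕ, @Subgroup.Normal (D.chart h𝒢 hcof hcn hS hfin hne).G (D.chart h𝒢 hcof hcn hS hfin hne).group ((D.piLevelAut h𝒢 hconn n).ker) :=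
    fun _ => MonoidHom.normal_ker _
  -- `hK1′` DERIVED (abc-iut-w6-d117's reduction at the chart, abc-iut-w4-d089 p440870)
  have hK1' := (D.hK1'_chart_of_eventually_congruenceContinuous_of_hself h𝒢 hcof hcn hS hfin hne hconn ρ' baseAct T R (isArithCompatible_piPresentation_outerAction_of_branchPair_chart_of_finite D h𝒢 hcof hcn hS hfin hne T R ρ' baseAct h37 hG hV hBR) d hker hG n₀ hself hCC)
  -- the level topology and its package (abc-iut-w6-d070)
  haveI hfc : FirstCountableTopology (D.chart h𝒢 hcof hcn hS hfin hne).G := TemperedPiChart.firstCountableTopology_G _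
  letI : TopologicalSpace (outerSemidirectProduct ρ') := @arithLevelTopology 𝒢 (D.chart h𝒢 hcof hcn hS hfin hne) PA _ _ _ ρ' baseAct
        (TemperedPiChart.firstCountableTopology_G (D.chart h𝒢 hcof hcn hS hfin hne)) h37.toProp36Hypotheses IsTempered.of_profinite (D.piPresentation h𝒢 T R)
        (isArithCompatible_piPresentation_outerAction_of_branchPair_chart_of_finite D h𝒢 hcof hcn hS hfin hne T R ρ' baseAct h37 hG hV hBR) w₀
        (D.isCompact_piPresentation_H h𝒢 T R w₀) (fun n => (D.projAut h𝒢 n).ker) (fun _ => MonoidHom.normal_ker _)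
        (D.hKst_and_hLst_of_ker_piLevelAut_eq_charOpenCore h𝒢 hconn T R ρ' (isArithCompatible_piPresentation_outerAction_of_branchPair_chart_of_finite D h𝒢 hcof hcn hS hfin hne T R ρ' baseAct h37 hG hV hBR) d hker).1
        (D.ker_projAut_anti h𝒢) (D.isOpen_ker_projAut h𝒢) (fun _ hU => D.exists_ker_projAut_subset h𝒢 hU) hK1'
  haveI := arithLevelTopology_isTopologicalGroup (D.chart h𝒢 hcof hcn hS hfin hne) ρ' baseAct h37.toProp36Hypotheses IsTempered.of_profinite (D.piPresentation h𝒢 T R) (isArithCompatible_piPresentation_outerAction_of_branchPair_chart_of_finite D h𝒢 hcof hcn hS hfin hne T R ρ' baseAct h37 hG hV hBR) w₀ (D.isCompact_piPresentation_H h𝒢 T R w₀) (fun n => (D.projAut h𝒢 n).ker) (fun _ => MonoidHom.normal_ker _) (D.hKst_and_hLst_of_ker_piLevelAut_eq_charOpenCore h𝒢 hconn T R ρ' (isArithCompatible_piPresentation_outerAction_of_branchPair_chart_of_finite D h𝒢 hcof hcn hS hfin hne T R ρ' baseAct h37 hG hV hBR) d hker).1 (D.ker_projAut_anti h𝒢)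 (D.isOpen_ker_projAut h𝒢) (fun _ hU => D.exists_ker_projAut_subset h𝒢 hU) hK1'
  haveI := arithLevelTopology_t2Space (D.chart h𝒢 hcof hcn hS hfin hne) ρ' baseAct h37.toProp36Hypotheses IsTempered.of_profinite (D.piPresentation h𝒢 T R) (isArithCompatible_piPresentation_outerAction_of_branchPair_chart_of_finite D h𝒢 hcof hcn hS hfin hne T R ρ' baseAct h37 hG hV hBR) w₀ (D.isCompact_piPresentation_H h𝒢 T R w₀) (fun n => (D.projAut h𝒢 n).ker) (fun _ => MonoidHom.normal_ker _) (D.hKst_and_hLst_of_ker_piLevelAut_eq_charOpenCore h𝒢 hconn T R ρ' (isArithCompatible_piPresentation_outerAction_of_branchPair_chart_of_finite D h𝒢 hcof hcn hS hfin hne T R ρ' baseAct h37 hG hV hBR) d hker).1 (D.ker_projAut_anti h𝒢) (D.isOpen_ker_projAut h𝒢) (fun _ hU => D.exists_ker_projAut_subset h𝒢 hU) hK1'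
  -- `Π_A` profinite ⇒ Hausdorff (points of a totally disconnected space are closed)
  haveI : T2Space PA := by
    rw [IsTopologicalGroup.t2Space_iff_one_closed,
      ← totallyDisconnectedSpace_iff_connectedComponent_singleton.mp inferInstance (1 : PA)]
    exact isClosed_connectedComponent
  haveI : T2Space (D.chart h𝒢 hcof hcn hS hfin hne).G := D.t2Space_temperedPi h𝒢
  -- `haugc`, `hLopen` at the finite levels (abc-iut-w6-d070)
  have haugc := continuous_outerSemidirectProductSnd (D.chart h𝒢 hcof hcn hS hfin hne) ρ' baseAct h37.toProp36Hypotheses IsTempered.of_profinite (D.piPresentation h𝒢 T R) (isArithCompatible_piPresentation_outerAction_of_branchPair_chart_of_finite D h𝒢 hcof hcn hS hfin hne T R ρ' baseAct h37 hG hV hBR) w₀ (D.isCompact_piPresentation_H h𝒢 T R w₀) (fun n => (D.projAut h𝒢 n).ker) (fun _ => MonoidHom.normal_ker _) (D.hKst_and_hLst_of_ker_piLevelAut_eq_charOpenCore h𝒢 hconn T R ρ' (isArithCompatible_piPresentation_outerAction_of_branchPair_chart_of_finite D h𝒢 hcof hcn hS hfin hne T R ρ' baseAct h37 hG hV hBR)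 d hker).1 (D.ker_projAut_anti h𝒢) (D.isOpen_ker_projAut h𝒢) (fun _ hU => D.exists_ker_projAut_subset h𝒢 hU) hK1'
  have hLopen : ∀ n, IsOpen (((D.piPresentation h𝒢 T R).arithAct (isArithCompatible_piPresentation_outerAction_of_branchPair_chart_of_finite D h𝒢 hcof hcn hS hfin hne T R ρ' baseAct h37 hG hV hBR) (D.piLevelAut h𝒢 hconn n).ker ((D.hKst_and_hLst_of_ker_piLevelAut_eq_charOpenCore h𝒢 hconn T R ρ' (isArithCompatible_piPresentation_outerAction_of_branchPair_chart_of_finite D h𝒢 hcof hcn hS hfin hne T R ρ' baseAct h37 hG hV hBR) d hker).2 n)).ker :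
      Set (outerSemidirectProduct ρ')) := fun n =>
    isOpen_ker_arithAct_of_le (D.chart h𝒢 hcof hcn hS hfin hne) ρ' baseAct h37.toProp36Hypotheses IsTempered.of_profinite (D.piPresentation h𝒢 T R) (isArithCompatible_piPresentation_outerAction_of_branchPair_chart_of_finite D h𝒢 hcof hcn hS hfin hne T R ρ' baseAct h37 hG hV hBR) w₀ (D.isCompact_piPresentation_H h𝒢 T R w₀) (fun n => (D.projAut h𝒢 n).ker) (fun _ => MonoidHom.normal_ker _) (D.hKst_and_hLst_of_ker_piLevelAut_eq_charOpenCore h𝒢 hconn T R ρ' (isArithCompatible_piPresentation_outerAction_of_branchPair_chart_of_finite D h𝒢 hcof hcn hS hfin hne T R ρ' baseAct h37 hG hV hBR) d hker).1 (D.ker_projAut_anti h𝒢) (D.isOpen_ker_projAut h𝒢) (fun _ hU => D.exists_ker_projAut_subset h𝒢 hU) hK1' ((D.hKst_and_hLst_of_ker_piLevelAut_eq_charOpenCore h𝒢 hconn T R ρ' (isArithCompatible_piPresentation_outerAction_of_branchPair_chart_of_finite D h𝒢 hcof hcn hS hfin hne T R ρ' baseAct h37 hG hV hBR) d hker).2 n)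 (D.ker_projAut_le_ker_piLevelAut h𝒢 hconn n)
  -- `hVc` package-free (abc-iut-w4-d059 `hVc_of_cosetTower`, [SemiAnbd] Rmk 5.3.1)
  have hVc : ∀ v, IsCompact (((decompositionDataOfChart Rc (toOuterSemidirectProduct ρ')).vertGp v :
      Subgroup (outerSemidirectProduct ρ')) : Set (outerSemidirectProduct ρ')) :=
    hVc_of_cosetTower (D.chart h𝒢 hcof hcn hS hfin hne) (D.piPresentation h𝒢 T R) (isArithCompatible_piPresentation_outerAction_of_branchPair_chart_of_finite D h𝒢 hcof hcn hS hfin hne T R ρ' baseAct h37 hG hV hBR) (toOuterSemidirectProduct ρ') hι (fun e x => conj_toOuterSemidirectProduct ρ' e x)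
      hιΦ hισ hPH Rc hRcV (fun n => (D.projAut h𝒢 n).ker) (D.hKst_and_hLst_of_ker_piLevelAut_eq_charOpenCore h𝒢 hconn T R ρ' (isArithCompatible_piPresentation_outerAction_of_branchPair_chart_of_finite D h𝒢 hcof hcn hS hfin hne T R ρ' baseAct h37 hG hV hBR) d hker).1 (D.piPresentation_hHK h𝒢 T R) h37
      (fun n => isOpen_ker_arithAct (D.chart h𝒢 hcof hcn hS hfin hne) ρ' baseAct h37.toProp36Hypotheses IsTempered.of_profinite (D.piPresentation h𝒢 T R) (isArithCompatible_piPresentation_outerAction_of_branchPair_chart_of_finite D h𝒢 hcof hcn hS hfin hne T R ρ' baseAct h37 hG hV hBR) w₀ (D.isCompact_piPresentation_H h𝒢 T R w₀) (fun n => (D.projAut h𝒢 n).ker) (fun _ => MonoidHom.normal_ker _) (D.hKst_and_hLst_of_ker_piLevelAut_eq_charOpenCore h𝒢 hconn T R ρ' (isArithCompatible_piPresentation_outerAction_of_branchPair_chart_of_finite D h𝒢 hcof hcn hS hfin hne T R ρ' baseAct h37 hG hV hBR) d hker).1 (D.ker_projAut_anti h𝒢) (D.isOpen_ker_projAut h𝒢)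 (fun _ hU => D.exists_ker_projAut_subset h𝒢 hU) hK1' n) (isTempered_arithLevelTopology (D.chart h𝒢 hcof hcn hS hfin hne) ρ' baseAct h37.toProp36Hypotheses IsTempered.of_profinite (D.piPresentation h𝒢 T R) (isArithCompatible_piPresentation_outerAction_of_branchPair_chart_of_finite D h𝒢 hcof hcn hS hfin hne T R ρ' baseAct h37 hG hV hBR) w₀ (D.isCompact_piPresentation_H h𝒢 T R w₀) (fun n => (D.projAut h𝒢 n).ker) (fun _ => MonoidHom.normal_ker _) (D.hKst_and_hLst_of_ker_piLevelAut_eq_charOpenCore h𝒢 hconn T R ρ' (isArithCompatible_piPresentation_outerAction_of_branchPair_chart_of_finite D h𝒢 hcof hcn hS hfin hne T R ρ' baseAct h37 hG hV hBR) d hker).1 (D.ker_projAut_anti h𝒢) (D.isOpen_ker_projAut h𝒢) (fun _ hU => D.exists_ker_projAut_subset h𝒢 hU) hK1')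
      (outerSemidirectProductSnd ρ') (arithLevelTopology_nhds_hasBasis (D.chart h𝒢 hcof hcn hS hfin hne) ρ' baseAct h37.toProp36Hypotheses IsTempered.of_profinite (D.piPresentation h𝒢 T R) (isArithCompatible_piPresentation_outerAction_of_branchPair_chart_of_finite D h𝒢 hcof hcn hS hfin hne T R ρ' baseAct h37 hG hV hBR) w₀ (D.isCompact_piPresentation_H h𝒢 T R w₀) (fun n => (D.projAut h𝒢 n).ker) (fun _ => MonoidHom.normal_ker _) (D.hKst_and_hLst_of_ker_piLevelAut_eq_charOpenCore h𝒢 hconn T R ρ' (isArithCompatible_piPresentation_outerAction_of_branchPair_chart_of_finite D h𝒢 hcof hcn hS hfin hne T R ρ' baseAct h37 hG hV hBR) d hker).1 (D.ker_projAut_anti h𝒢) (D.isOpen_ker_projAut h𝒢) (fun _ hU => D.exists_ker_projAut_subset h𝒢 hU) hK1') hex.symm.le hK1'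
      (D.isOpen_ker_projAut h𝒢)
  -- `hUclosed` (abc-iut-w4-d085)
  have hUclosed : ∀ n : ℕ, IsClosed ((((((D.piPresentation h𝒢 T R).arithAct (isArithCompatible_piPresentation_outerAction_of_branchPair_chart_of_finite D h𝒢 hcof hcn hS hfin hne T R ρ' baseAct h37 hG hV hBR) (D.piLevelAut h𝒢 hconn n).ker
      ((D.hKst_and_hLst_of_ker_piLevelAut_eq_charOpenCore h𝒢 hconn T R ρ' (isArithCompatible_piPresentation_outerAction_of_branchPair_chart_of_finite D h𝒢 hcof hcn hS hfin hne T R ρ' baseAct h37 hG hV hBR) d hker).2 n)).ker).map (outerSemidirectProductSnd ρ') : Subgroup PA) : Set PA)) := fun n =>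
    isClosed_map_ker_arithAct_arithLevelTopology (D.chart h𝒢 hcof hcn hS hfin hne) ρ' baseAct (D.piPresentation h𝒢 T R) (isArithCompatible_piPresentation_outerAction_of_branchPair_chart_of_finite D h𝒢 hcof hcn hS hfin hne T R ρ' baseAct h37 hG hV hBR) h37.toProp36Hypotheses
      IsTempered.of_profinite w₀ (D.isCompact_piPresentation_H h𝒢 T R w₀) (fun n => (D.projAut h𝒢 n).ker)
      (fun _ => MonoidHom.normal_ker _) (D.hKst_and_hLst_of_ker_piLevelAut_eq_charOpenCore h𝒢 hconn T R ρ' (isArithCompatible_piPresentation_outerAction_of_branchPair_chart_of_finite D h𝒢 hcof hcn hS hfin hne T R ρ' baseAct h37 hG hV hBR) d hker).1 (D.ker_projAut_anti h𝒢) (D.isOpen_ker_projAut h𝒢)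
      (fun _ hU => D.exists_ker_projAut_subset h𝒢 hU) hK1' ((D.hKst_and_hLst_of_ker_piLevelAut_eq_charOpenCore h𝒢 hconn T R ρ' (isArithCompatible_piPresentation_outerAction_of_branchPair_chart_of_finite D h𝒢 hcof hcn hS hfin hne T R ρ' baseAct h37 hG hV hBR) d hker).2 n) (D.ker_projAut_le_ker_piLevelAut h𝒢 hconn n)
  -- "hUρ" (abc-iut-w4-d085 Corollary D, from `hR`/`hnobp`) ⇒ "hU-arith" ⇒ `hU`
  have hU : ∀ (v₀ : 𝒢.graph.Vertex) (a : PA), (∀ n : ℕ, a ∈ (((D.piPresentation h𝒢 T R).arithAct (isArithCompatible_piPresentation_outerAction_of_branchPair_chart_of_finite D h𝒢 hcof hcn hS hfin hne T R ρ' baseAct h37 hG hV hBR)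
        (D.piLevelAut h𝒢 hconn n).ker ((D.hKst_and_hLst_of_ker_piLevelAut_eq_charOpenCore h𝒢 hconn T R ρ' (isArithCompatible_piPresentation_outerAction_of_branchPair_chart_of_finite D h𝒢 hcof hcn hS hfin hne T R ρ' baseAct h37 hG hV hBR) d hker).2 n)).ker).map (outerSemidirectProductSnd ρ')) →
      ∃ z ∈ (decompositionDataOfChart Rc (toOuterSemidirectProduct ρ')).vertGp v₀, outerSemidirectProductSnd ρ' z = a ∧
        ∀ n : ℕ, (D.piPresentation h𝒢 T R).arithAct (isArithCompatible_piPresentation_outerAction_of_branchPair_chart_of_finite D h𝒢 hcof hcn hS hfin hne T R ρ' baseAct h37 hG hV hBR) (D.piLevelAut h𝒢 hconn n).ker ((D.hKst_and_hLst_of_ker_piLevelAut_eq_charOpenCore h𝒢 hconn T R ρ' (isArithCompatible_piPresentation_outerAction_of_branchPair_chart_of_finite D h𝒢 hcof hcn hS hfin hne T R ρ' baseAct h37 hG hV hBR) d hker).2 n) z = 1 := fun v₀ =>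
    hU_arithVertGp_of_iInf_map_ker_le (D.chart h𝒢 hcof hcn hS hfin hne) ρ' baseAct (D.piPresentation h𝒢 T R) (isArithCompatible_piPresentation_outerAction_of_branchPair_chart_of_finite D h𝒢 hcof hcn hS hfin hne T R ρ' baseAct h37 hG hV hBR) (fun n => (D.piLevelAut h𝒢 hconn n).ker)
      (D.hKst_and_hLst_of_ker_piLevelAut_eq_charOpenCore h𝒢 hconn T R ρ' (isArithCompatible_piPresentation_outerAction_of_branchPair_chart_of_finite D h𝒢 hcof hcn hS hfin hne T R ρ' baseAct h37 hG hV hBR) d hker).2 Rc v₀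
      (iInf_map_ker_le_of_le_ker_rho (D.chart h𝒢 hcof hcn hS hfin hne) ρ' baseAct (D.piPresentation h𝒢 T R) (isArithCompatible_piPresentation_outerAction_of_branchPair_chart_of_finite D h𝒢 hcof hcn hS hfin hne T R ρ' baseAct h37 hG hV hBR) (fun n => (D.piLevelAut h𝒢 hconn n).ker) (D.hKst_and_hLst_of_ker_piLevelAut_eq_charOpenCore h𝒢 hconn T R ρ' (isArithCompatible_piPresentation_outerAction_of_branchPair_chart_of_finite D h𝒢 hcof hcn hS hfin hne T R ρ' baseAct h37 hG hV hBR) d hker).2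
        fun a ha => mem_ker_of_mem_iInf_map_ker_arithAct_outerAction (D.chart h𝒢 hcof hcn hS hfin hne) ρ' baseAct (D.piPresentation h𝒢 T R) (isArithCompatible_piPresentation_outerAction_of_branchPair_chart_of_finite D h𝒢 hcof hcn hS hfin hne T R ρ' baseAct h37 hG hV hBR) hex
          (fun n => (D.projAut h𝒢 n).ker) (D.ker_projAut_anti h𝒢) (D.hKst_and_hLst_of_ker_piLevelAut_eq_charOpenCore h𝒢 hconn T R ρ' (isArithCompatible_piPresentation_outerAction_of_branchPair_chart_of_finite D h𝒢 hcof hcn hS hfin hne T R ρ' baseAct h37 hG hV hBR) d hker).1 (D.piPresentation_hHK h𝒢 T R)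
          (D.piPresentation_hlift h𝒢 T R) (fun n => (D.piLevelAut h𝒢 hconn n).ker) (D.hKst_and_hLst_of_ker_piLevelAut_eq_charOpenCore h𝒢 hconn T R ρ' (isArithCompatible_piPresentation_outerAction_of_branchPair_chart_of_finite D h𝒢 hcof hcn hS hfin hne T R ρ' baseAct h37 hG hV hBR) d hker).2
          (fun n => D.ker_projAut_le_ker_piLevelAut h𝒢 hconn n) (fun n => D.isOpen_ker_piLevelAut h𝒢 hconn n)
          (D.ker_piLevelAut_anti h𝒢 hconn) v₀ hHc hR hnobp ha)
      (fun n => (D.piLevelAut h𝒢 hconn n).ker) (D.hKst_and_hLst_of_ker_piLevelAut_eq_charOpenCore h𝒢 hconn T R ρ' (isArithCompatible_piPresentation_outerAction_of_branchPair_chart_of_finite D h𝒢 hcof hcn hS hfin hne T R ρ' baseAct h37 hG hV hBR) d hker).2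
  -- `hnobpNCpt` (abc-iut-w4-d053's chart transport of abc-iut-w4-d083's producer, mod (I0v))
  have hnobpNCpt := hnobpNCpt_cosetTower_of_faithV_chart D h𝒢 hcof hcn hS hfin hne hconn T R h37 (isArithCompatible_piPresentation_outerAction_of_branchPair_chart_of_finite D h𝒢 hcof hcn hS hfin hne T R ρ' baseAct h37 hG hV hBR) (D.hKst_and_hLst_of_ker_piLevelAut_eq_charOpenCore h𝒢 hconn T R ρ' (isArithCompatible_piPresentation_outerAction_of_branchPair_chart_of_finite D h𝒢 hcof hcn hS hfin hne T R ρ' baseAct h37 hG hV hBR) d hker).2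
    (toOuterSemidirectProduct ρ') hιΦ hισ hfaithV
  -- (AI4″) `stabBranchPairAug` PRODUCED (abc-iut-w4-d059 p442253, hcof-free form over abc-iut-w4-d085)
  have stabBranchPairAug := stabBranchPairAug_chart_outerAction_modKernel D h𝒢 hcof hcn hS hfin hne hconn h37 T R
    ρ' baseAct (isArithCompatible_piPresentation_outerAction_of_branchPair_chart_of_finite D h𝒢 hcof hcn hS hfin hne T R ρ' baseAct h37 hG hV hBR) (D.hKst_and_hLst_of_ker_piLevelAut_eq_charOpenCore h𝒢 hconn T R ρ' (isArithCompatible_piPresentation_outerAction_of_branchPair_chart_of_finite D h𝒢 hcof hcn hS hfin hne T R ρ' baseAct h37 hG hV hBR) d hker).2 haugc Rc hRcV hRcB hLopen hVc hUclosed hU hnobpNCpt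
  exact arithMaximalCompactStatement_outerAction_piPresentation_chart_of_producers_levelTopology D h𝒢 hcof hcn hS hfin hne hconn
    h37 hG ρ' baseAct T R Rc hV hE hopen hBR w₀ d hker hfaithV hK1' rfl noSwitchBase stabBranchPairAug hest hbot

end Chart

/-! ### The characteristic tower: CAPSTONE v4 -/

/-- **[SemiAnbd] Thm 5.4 (i) ∧ (ii) at `π₁^temp(𝒢) ⋊^out Π_A` for the chart of the CHARACTERISTIC Galois tower —
CAPSTONE v4**: the theorem of record `…_charCores_of_designData` (p440359) with (AI4″) `stabBranchPairAug` now
PRODUCED (abc-iut-w4-d059 / abc-iut-w4-d085 / abc-iut-w6-d070, bound inside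
`…_chart_of_designData_of_congruenceContinuous`) and the continuity binder `hK1′` REDUCED to `hself` + `hCC` at
the deep tree levels (abc-iut-w6-d117 / abc-iut-w4-d089); `hker` and (I0v) are the characteristic-tower
THEOREMS `ofCharCores_ker_piLevelAut_eq_charOpenCore` / `faithfulV_ofCharCores`.  HONEST RESIDUAL: design data
`hV hE hopen hBR` (Prop 3.6 (iv) / Def 5.1 (i)(c)), `hRcV`/`hRcB` (representatives read off the presentation),
`n₀`/`hself` (theorem at the canonical tower, abc-iut-w6-d117 p442124; its characteristic-tower twin is owed) /
`hCC` (Def 5.1 (i)(c)/(d), DESIGN), `hinst` (`rfl` at consumers), `noSwitchBase`, `hR` ([SemiAnbd] Prop 3.6 (iii)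
along the characteristic levels — abc-iut-w4-d085, α97) and `hnobp` (estrangement test ⟸ `hnobpNCpt` at one
branch-pair system — abc-iut-w4-d085), Thm 5.4's own `hest`/`hbot`, the §5 frame and Def 5.1 (i) coherence.
Nothing beyond composition is proved here. [cite: MochizukiSemiAnbd2006, Thm 5.4 (i), p. 66] -/
theorem arithMaximalCompactStatement_outerAction_piPresentation_charCores_of_designData_of_congruenceContinuous
    (h37 : 𝒢.Thm37Hypotheses) (hG : 𝒢.graph.IsGraph) [Finite 𝒢.graph.Vertex] [Finite 𝒢.graph.Branch]
    [Finite 𝒢.graph.Edge] (v₀ : 𝒢.graph.Vertex)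
    -- coherence (Def 5.1 (i)): topologically finitely generated constituents — the input of the characteristic tower
    (hVt : ∀ v : 𝒢.graph.Vertex, IsTopologicallyFinitelyGenerated (𝒢.Gv v))
    (hEt : ∀ e : 𝒢.graph.Edge, IsTopologicallyFinitelyGenerated (𝒢.Ge e))
    {PA : Type u} [Group PA] [TopologicalSpace PA] [IsTopologicalGroup PA] [CompactSpace PA]
    [TotallyDisconnectedSpace PA]
    (ρ' : PA →* TopOut ((GaloisLevelData.ofCharCores h37.toProp36Hypotheses v₀ hVt hEt).chart h37.toProp36Hypotheses.isCountable (ofCharCores_exists_level_splits_component h37.toProp36Hypotheses v₀ hVt hEt) h37.toProp36Hypotheses.isConnected (ofCharCores_splits_self h37.toProp36Hypotheses v₀ hVt hEt) (ofCharCores_isFinite h37.toProp36Hypotheses v₀ hVt hEt) (ofCharCores_hasNonemptyFibres h37.toProp36Hypotheses v₀ hVt hEt)).G) (baseAct : PA →* Aut 𝒢.graph)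
    [inst : TopologicalSpace (outerSemidirectProduct ρ')]
    (T : ∀ w : 𝒢.graph.Vertex, (GaloisLevelData.ofCharCores h37.toProp36Hypotheses v₀ hVt hEt).PointSeq h37.toProp36Hypotheses.isCountable w) (R : SemiGraph.RefBranches 𝒢.graph)
    -- §3 representatives MATCHED to the presentation (abc-iut-w4-d059's `hRcV`/`hRcB`)
    (Rc : ChartRepresentatives ((GaloisLevelData.ofCharCores h37.toProp36Hypotheses v₀ hVt hEt).chart h37.toProp36Hypotheses.isCountable (ofCharCores_exists_level_splits_component h37.toProp36Hypotheses v₀ hVt hEt) h37.toProp36Hypotheses.isConnected (ofCharCores_splits_self h37.toProp36Hypotheses v₀ hVt hEt) (ofCharCores_isFinite h37.toProp36Hypotheses v₀ hVt hEt) (ofCharCores_hasNonemptyFibres h37.toProp36Hypotheses v₀ hVt hEt)))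
    (hRcV : ∀ v, Rc.Hv v = ((GaloisLevelData.ofCharCores h37.toProp36Hypotheses v₀ hVt hEt).piPresentation h37.toProp36Hypotheses.isCountable T R).H v)
    (hRcB : ∀ b, Rc.Hb b = (((GaloisLevelData.ofCharCores h37.toProp36Hypotheses v₀ hVt hEt).piPresentation h37.toProp36Hypotheses.isCountable T R).M (𝒢.graph.edgeOf b)).map
      (MulAut.conj (((GaloisLevelData.ofCharCores h37.toProp36Hypotheses v₀ hVt hEt).piPresentation h37.toProp36Hypotheses.isCountable T R).s b)).toMonoidHom)
    -- Prop 3.6 (iv) at `ρ_𝔾(a)` / Def 5.1 (i)(c): the DESIGN data of the outer model (abc-iut-w4-d082's currency)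
    (hV : ∀ (a : PA) (v : 𝒢.graph.Vertex) (H : Subgroup ((GaloisLevelData.ofCharCores h37.toProp36Hypotheses v₀ hVt hEt).chart h37.toProp36Hypotheses.isCountable (ofCharCores_exists_level_splits_component h37.toProp36Hypotheses v₀ hVt hEt) h37.toProp36Hypotheses.isConnected (ofCharCores_splits_self h37.toProp36Hypotheses v₀ hVt hEt) (ofCharCores_isFinite h37.toProp36Hypotheses v₀ hVt hEt) (ofCharCores_hasNonemptyFibres h37.toProp36Hypotheses v₀ hVt hEt)).G), H ∈ verticialSubgroups ((GaloisLevelData.ofCharCores h37.toProp36Hypotheses v₀ hVt hEt).chart h37.toProp36Hypotheses.isCountable (ofCharCores_exists_level_splits_component h37.toProp36Hypotheses v₀ hVt hEt) h37.toProp36Hypotheses.isConnected (ofCharCores_splits_self h37.toProp36Hypotheses v₀ hVt hEt) (ofCharCores_isFinite h37.toProp36Hypotheses v₀ hVt hEt) (ofCharCores_hasNonemptyFibres h37.toProp36Hypotheses v₀ hVt hEt)) v →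
      ∃ φ : contMulAut ((GaloisLevelData.ofCharCores h37.toProp36Hypotheses v₀ hVt hEt).chart h37.toProp36Hypotheses.isCountable (ofCharCores_exists_level_splits_component h37.toProp36Hypotheses v₀ hVt hEt) h37.toProp36Hypotheses.isConnected (ofCharCores_splits_self h37.toProp36Hypotheses v₀ hVt hEt) (ofCharCores_isFinite h37.toProp36Hypotheses v₀ hVt hEt) (ofCharCores_hasNonemptyFibres h37.toProp36Hypotheses v₀ hVt hEt)).G, TopOut.mk _ φ = ρ' a ∧
        H.map (φ : MulAut ((GaloisLevelData.ofCharCores h37.toProp36Hypotheses v₀ hVt hEt).chart h37.toProp36Hypotheses.isCountable (ofCharCores_exists_level_splits_component h37.toProp36Hypotheses v₀ hVt hEt) h37.toProp36Hypotheses.isConnected (ofCharCores_splits_self h37.toProp36Hypotheses v₀ hVt hEt) (ofCharCores_isFinite h37.toProp36Hypotheses v₀ hVt hEt) (ofCharCores_hasNonemptyFibres h37.toProp36Hypotheses v₀ hVt hEt)).G).toMonoidHom ∈ verticialSubgroups ((GaloisLevelData.ofCharCores h37.toProp36Hypotheses v₀ hVt hEt).chart h37.toProp36Hypotheses.isCountable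 (ofCharCores_exists_level_splits_component h37.toProp36Hypotheses v₀ hVt hEt) h37.toProp36Hypotheses.isConnected (ofCharCores_splits_self h37.toProp36Hypotheses v₀ hVt hEt) (ofCharCores_isFinite h37.toProp36Hypotheses v₀ hVt hEt) (ofCharCores_hasNonemptyFibres h37.toProp36Hypotheses v₀ hVt hEt)) ((baseAct a).hom.vertexMap v))
    (hE : ∀ (a : PA) (e : 𝒢.graph.Edge) (K : Subgroup ((GaloisLevelData.ofCharCores h37.toProp36Hypotheses v₀ hVt hEt).chart h37.toProp36Hypotheses.isCountable (ofCharCores_exists_level_splits_component h37.toProp36Hypotheses v₀ hVt hEt) h37.toProp36Hypotheses.isConnected (ofCharCores_splits_self h37.toProp36Hypotheses v₀ hVt hEt) (ofCharCores_isFinite h37.toProp36Hypotheses v₀ hVt hEt) (ofCharCores_hasNonemptyFibres h37.toProp36Hypotheses v₀ hVt hEt)).G), K ∈ edgeLikeSubgroups ((GaloisLevelData.ofCharCores h37.toProp36Hypotheses v₀ hVt hEt).chart h37.toProp36Hypotheses.isCountable (ofCharCores_exists_level_splits_component h37.toProp36Hypotheses v₀ hVt hEt) h37.toProp36Hypotheses.isConnected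 (ofCharCores_splits_self h37.toProp36Hypotheses v₀ hVt hEt) (ofCharCores_isFinite h37.toProp36Hypotheses v₀ hVt hEt) (ofCharCores_hasNonemptyFibres h37.toProp36Hypotheses v₀ hVt hEt)) e →
      ∃ φ : contMulAut ((GaloisLevelData.ofCharCores h37.toProp36Hypotheses v₀ hVt hEt).chart h37.toProp36Hypotheses.isCountable (ofCharCores_exists_level_splits_component h37.toProp36Hypotheses v₀ hVt hEt) h37.toProp36Hypotheses.isConnected (ofCharCores_splits_self h37.toProp36Hypotheses v₀ hVt hEt) (ofCharCores_isFinite h37.toProp36Hypotheses v₀ hVt hEt) (ofCharCores_hasNonemptyFibres h37.toProp36Hypotheses v₀ hVt hEt)).G, TopOut.mk _ φ = ρ' a ∧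
        K.map (φ : MulAut ((GaloisLevelData.ofCharCores h37.toProp36Hypotheses v₀ hVt hEt).chart h37.toProp36Hypotheses.isCountable (ofCharCores_exists_level_splits_component h37.toProp36Hypotheses v₀ hVt hEt) h37.toProp36Hypotheses.isConnected (ofCharCores_splits_self h37.toProp36Hypotheses v₀ hVt hEt) (ofCharCores_isFinite h37.toProp36Hypotheses v₀ hVt hEt) (ofCharCores_hasNonemptyFibres h37.toProp36Hypotheses v₀ hVt hEt)).G).toMonoidHom ∈ edgeLikeSubgroups ((GaloisLevelData.ofCharCores h37.toProp36Hypotheses v₀ hVt hEt).chart h37.toProp36Hypotheses.isCountable (ofCharCores_exists_level_splits_component h37.toProp36Hypotheses v₀ hVt hEt) h37.toProp36Hypotheses.isConnected (ofCharCores_splits_self h37.toProp36Hypotheses v₀ hVt hEt) (ofCharCores_isFinite h37.toProp36Hypotheses v₀ hVt hEt) (ofCharCores_hasNonemptyFibres h37.toProp36Hypotheses v₀ hVt hEt)) ((baseAct a).hom.edgeMap e))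
    (hopen : ∃ U : Subgroup PA, IsOpen (U : Set PA) ∧ ∀ a ∈ U,
      (∀ v, (baseAct a).hom.vertexMap v = v) ∧ (∀ e, (baseAct a).hom.edgeMap e = e) ∧
        ∀ b, (baseAct a).hom.branchMap b = b)
    (hBR : ∀ (a : PA) (b : 𝒢.graph.Branch) (v : 𝒢.graph.Vertex) (hb : 𝒢.graph.abuts b = some v)
      (φ : 𝒢.Gv v →ₜ* ((GaloisLevelData.ofCharCores h37.toProp36Hypotheses v₀ hVt hEt).chart h37.toProp36Hypotheses.isCountable (ofCharCores_exists_level_splits_component h37.toProp36Hypotheses v₀ hVt hEt) h37.toProp36Hypotheses.isConnected (ofCharCores_splits_self h37.toProp36Hypotheses v₀ hVt hEt) (ofCharCores_isFinite h37.toProp36Hypotheses v₀ hVt hEt) (ofCharCores_hasNonemptyFibres h37.toProp36Hypotheses v₀ hVt hEt)).G), IsVerticialHom ((GaloisLevelData.ofCharCores h37.toProp36Hypotheses v₀ hVt hEt).chart h37.toProp36Hypotheses.isCountable (ofCharCores_exists_level_splits_component h37.toProp36Hypotheses v₀ hVt hEt) h37.toProp36Hypotheses.isConnected (ofCharCores_splits_self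 h37.toProp36Hypotheses v₀ hVt hEt) (ofCharCores_isFinite h37.toProp36Hypotheses v₀ hVt hEt) (ofCharCores_hasNonemptyFibres h37.toProp36Hypotheses v₀ hVt hEt)) v φ →
      ∃ Φ : contMulAut ((GaloisLevelData.ofCharCores h37.toProp36Hypotheses v₀ hVt hEt).chart h37.toProp36Hypotheses.isCountable (ofCharCores_exists_level_splits_component h37.toProp36Hypotheses v₀ hVt hEt) h37.toProp36Hypotheses.isConnected (ofCharCores_splits_self h37.toProp36Hypotheses v₀ hVt hEt) (ofCharCores_isFinite h37.toProp36Hypotheses v₀ hVt hEt) (ofCharCores_hasNonemptyFibres h37.toProp36Hypotheses v₀ hVt hEt)).G, TopOut.mk _ Φ = ρ' a ∧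
        ∃ φ' : 𝒢.Gv ((baseAct a).hom.vertexMap v) →ₜ* ((GaloisLevelData.ofCharCores h37.toProp36Hypotheses v₀ hVt hEt).chart h37.toProp36Hypotheses.isCountable (ofCharCores_exists_level_splits_component h37.toProp36Hypotheses v₀ hVt hEt) h37.toProp36Hypotheses.isConnected (ofCharCores_splits_self h37.toProp36Hypotheses v₀ hVt hEt) (ofCharCores_isFinite h37.toProp36Hypotheses v₀ hVt hEt) (ofCharCores_hasNonemptyFibres h37.toProp36Hypotheses v₀ hVt hEt)).G,
          IsVerticialHom ((GaloisLevelData.ofCharCores h37.toProp36Hypotheses v₀ hVt hEt).chart h37.toProp36Hypotheses.isCountable (ofCharCores_exists_level_splits_component h37.toProp36Hypotheses v₀ hVt hEt) h37.toProp36Hypotheses.isConnected (ofCharCores_splits_self h37.toProp36Hypotheses v₀ hVt hEt) (ofCharCores_isFinite h37.toProp36Hypotheses v₀ hVt hEt) (ofCharCores_hasNonemptyFibres h37.toProp36Hypotheses v₀ hVt hEt)) ((baseAct a).hom.vertexMap v) φ' ∧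
          ∃ x' : ((GaloisLevelData.ofCharCores h37.toProp36Hypotheses v₀ hVt hEt).chart h37.toProp36Hypotheses.isCountable (ofCharCores_exists_level_splits_component h37.toProp36Hypotheses v₀ hVt hEt) h37.toProp36Hypotheses.isConnected (ofCharCores_splits_self h37.toProp36Hypotheses v₀ hVt hEt) (ofCharCores_isFinite h37.toProp36Hypotheses v₀ hVt hEt) (ofCharCores_hasNonemptyFibres h37.toProp36Hypotheses v₀ hVt hEt)).G,
            Subgroup.map (Φ : MulAut ((GaloisLevelData.ofCharCores h37.toProp36Hypotheses v₀ hVt hEt).chart h37.toProp36Hypotheses.isCountable (ofCharCores_exists_level_splits_component h37.toProp36Hypotheses v₀ hVt hEt) h37.toProp36Hypotheses.isConnected (ofCharCores_splits_self h37.toProp36Hypotheses v₀ hVt hEt) (ofCharCores_isFinite h37.toProp36Hypotheses v₀ hVt hEt) (ofCharCores_hasNonemptyFibres h37.toProp36Hypotheses v₀ hVt hEt)).G).toMonoidHom φ.toMonoidHom.range =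
              Subgroup.map (MulAut.conj x').toMonoidHom φ'.toMonoidHom.range ∧
            Subgroup.map (Φ : MulAut ((GaloisLevelData.ofCharCores h37.toProp36Hypotheses v₀ hVt hEt).chart h37.toProp36Hypotheses.isCountable (ofCharCores_exists_level_splits_component h37.toProp36Hypotheses v₀ hVt hEt) h37.toProp36Hypotheses.isConnected (ofCharCores_splits_self h37.toProp36Hypotheses v₀ hVt hEt) (ofCharCores_isFinite h37.toProp36Hypotheses v₀ hVt hEt) (ofCharCores_hasNonemptyFibres h37.toProp36Hypotheses v₀ hVt hEt)).G).toMonoidHom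
                (Subgroup.map φ.toMonoidHom (𝒢.branchSubgroup b v hb)) =
              Subgroup.map (MulAut.conj x').toMonoidHom
                (Subgroup.map φ'.toMonoidHom
                  (𝒢.branchSubgroup ((baseAct a).hom.branchMap b) ((baseAct a).hom.vertexMap v)
                    ((baseAct a).hom.abuts_branchMap b v hb))))
    (w₀ : 𝒢.graph.Vertex)
    -- the reduction of the continuity binder `hK1′` (abc-iut-w6-d117 / abc-iut-w4-d089 p440870): beyond depth `n₀`
    -- the vertex images are SELF-NORMALISING in the tree-level quotients (`hself`; a THEOREM at the canonical
    -- tower, abc-iut-w6-d117 p442124) and the outer action is CONGRUENCE-CONTINUOUS with trivial base action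
    -- near `1` (`hCC`, Def 5.1 (i)(c)/(d) — DESIGN)
    (n₀ : ℕ)
    (hself : ∀ n, n₀ ≤ n → ∀ (w : 𝒢.graph.Vertex)
      (q : ((GaloisLevelData.ofCharCores h37.toProp36Hypotheses v₀ hVt hEt).chart h37.toProp36Hypotheses.isCountable (ofCharCores_exists_level_splits_component h37.toProp36Hypotheses v₀ hVt hEt) h37.toProp36Hypotheses.isConnected (ofCharCores_splits_self h37.toProp36Hypotheses v₀ hVt hEt) (ofCharCores_isFinite h37.toProp36Hypotheses v₀ hVt hEt) (ofCharCores_hasNonemptyFibres h37.toProp36Hypotheses v₀ hVt hEt)).G ⧸ ((GaloisLevelData.ofCharCores h37.toProp36Hypotheses v₀ hVt hEt).projAut h37.toProp36Hypotheses.isCountable n).ker),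
      (∀ x : ((GaloisLevelData.ofCharCores h37.toProp36Hypotheses v₀ hVt hEt).chart h37.toProp36Hypotheses.isCountable (ofCharCores_exists_level_splits_component h37.toProp36Hypotheses v₀ hVt hEt) h37.toProp36Hypotheses.isConnected (ofCharCores_splits_self h37.toProp36Hypotheses v₀ hVt hEt) (ofCharCores_isFinite h37.toProp36Hypotheses v₀ hVt hEt) (ofCharCores_hasNonemptyFibres h37.toProp36Hypotheses v₀ hVt hEt)).G ⧸ ((GaloisLevelData.ofCharCores h37.toProp36Hypotheses v₀ hVt hEt).projAut h37.toProp36Hypotheses.isCountable n).ker,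
        x ∈ (((GaloisLevelData.ofCharCores h37.toProp36Hypotheses v₀ hVt hEt).piPresentation h37.toProp36Hypotheses.isCountable T R).H w).map (QuotientGroup.mk' _) ↔
        q⁻¹ * x * q ∈ (((GaloisLevelData.ofCharCores h37.toProp36Hypotheses v₀ hVt hEt).piPresentation h37.toProp36Hypotheses.isCountable T R).H w).map (QuotientGroup.mk' _)) →
      q ∈ (((GaloisLevelData.ofCharCores h37.toProp36Hypotheses v₀ hVt hEt).piPresentation h37.toProp36Hypotheses.isCountable T R).H w).map (QuotientGroup.mk' _))
    (hCC : ∀ n, n₀ ≤ n → ∃ U ∈ 𝓝 (1 : PA), ∀ a ∈ U, baseAct a = 1 ∧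
      ∃ φ : contMulAut ((GaloisLevelData.ofCharCores h37.toProp36Hypotheses v₀ hVt hEt).chart h37.toProp36Hypotheses.isCountable (ofCharCores_exists_level_splits_component h37.toProp36Hypotheses v₀ hVt hEt) h37.toProp36Hypotheses.isConnected (ofCharCores_splits_self h37.toProp36Hypotheses v₀ hVt hEt) (ofCharCores_isFinite h37.toProp36Hypotheses v₀ hVt hEt) (ofCharCores_hasNonemptyFibres h37.toProp36Hypotheses v₀ hVt hEt)).G, TopOut.mk ((GaloisLevelData.ofCharCores h37.toProp36Hypotheses v₀ hVt hEt).chart h37.toProp36Hypotheses.isCountable (ofCharCores_exists_level_splits_component h37.toProp36Hypotheses v₀ hVt hEt) h37.toProp36Hypotheses.isConnected (ofCharCores_splits_self h37.toProp36Hypotheses v₀ hVt hEt) (ofCharCores_isFinite h37.toProp36Hypotheses v₀ hVt hEt) (ofCharCores_hasNonemptyFibres h37.toProp36Hypotheses v₀ hVt hEt)).G φ = ρ' a ∧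
        ∀ y : ((GaloisLevelData.ofCharCores h37.toProp36Hypotheses v₀ hVt hEt).chart h37.toProp36Hypotheses.isCountable (ofCharCores_exists_level_splits_component h37.toProp36Hypotheses v₀ hVt hEt) h37.toProp36Hypotheses.isConnected (ofCharCores_splits_self h37.toProp36Hypotheses v₀ hVt hEt) (ofCharCores_isFinite h37.toProp36Hypotheses v₀ hVt hEt) (ofCharCores_hasNonemptyFibres h37.toProp36Hypotheses v₀ hVt hEt)).G, (φ : MulAut ((GaloisLevelData.ofCharCores h37.toProp36Hypotheses v₀ hVt hEt).chart h37.toProp36Hypotheses.isCountable (ofCharCores_exists_level_splits_component h37.toProp36Hypotheses v₀ hVt hEt) h37.toProp36Hypotheses.isConnected (ofCharCores_splits_self h37.toProp36Hypotheses v₀ hVt hEt) (ofCharCores_isFinite h37.toProp36Hypotheses v₀ hVt hEt) (ofCharCores_hasNonemptyFibres h37.toProp36Hypotheses v₀ hVt hEt)).G) y * y⁻¹ ∈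
          ((GaloisLevelData.ofCharCores h37.toProp36Hypotheses v₀ hVt hEt).projAut h37.toProp36Hypotheses.isCountable n).ker)
    -- the topology of `E` IS abc-iut-w6-d070's tempered level topology at the chart of the tower (`hK1′` := the
    -- term derived from `hself`/`hCC`)
    (hinst : inst = @arithLevelTopology 𝒢 ((GaloisLevelData.ofCharCores h37.toProp36Hypotheses v₀ hVt hEt).chart h37.toProp36Hypotheses.isCountable (ofCharCores_exists_level_splits_component h37.toProp36Hypotheses v₀ hVt hEt) h37.toProp36Hypotheses.isConnected (ofCharCores_splits_self h37.toProp36Hypotheses v₀ hVt hEt) (ofCharCores_isFinite h37.toProp36Hypotheses v₀ hVt hEt) (ofCharCores_hasNonemptyFibres h37.toProp36Hypotheses v₀ hVt hEt)) PA _ _ _ ρ' baseAct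
        (TemperedPiChart.firstCountableTopology_G ((GaloisLevelData.ofCharCores h37.toProp36Hypotheses v₀ hVt hEt).chart h37.toProp36Hypotheses.isCountable (ofCharCores_exists_level_splits_component h37.toProp36Hypotheses v₀ hVt hEt) h37.toProp36Hypotheses.isConnected (ofCharCores_splits_self h37.toProp36Hypotheses v₀ hVt hEt) (ofCharCores_isFinite h37.toProp36Hypotheses v₀ hVt hEt) (ofCharCores_hasNonemptyFibres h37.toProp36Hypotheses v₀ hVt hEt))) h37.toProp36Hypotheses IsTempered.of_profinite ((GaloisLevelData.ofCharCores h37.toProp36Hypotheses v₀ hVt hEt).piPresentation h37.toProp36Hypotheses.isCountable T R)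
        (isArithCompatible_piPresentation_outerAction_of_branchPair_chart_of_finite (GaloisLevelData.ofCharCores h37.toProp36Hypotheses v₀ hVt hEt) h37.toProp36Hypotheses.isCountable (ofCharCores_exists_level_splits_component h37.toProp36Hypotheses v₀ hVt hEt) h37.toProp36Hypotheses.isConnected (ofCharCores_splits_self h37.toProp36Hypotheses v₀ hVt hEt) (ofCharCores_isFinite h37.toProp36Hypotheses v₀ hVt hEt) (ofCharCores_hasNonemptyFibres h37.toProp36Hypotheses v₀ hVt hEt) T R ρ' baseAct h37 hG hV hBR) w₀
        ((GaloisLevelData.ofCharCores h37.toProp36Hypotheses v₀ hVt hEt).isCompact_piPresentation_H h37.toProp36Hypotheses.isCountable T R w₀) (fun n => ((GaloisLevelData.ofCharCores h37.toProp36Hypotheses v₀ hVt hEt).projAut h37.toProp36Hypotheses.isCountable n).ker) (fun _ => MonoidHom.normal_ker _)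
        ((GaloisLevelData.ofCharCores h37.toProp36Hypotheses v₀ hVt hEt).hKst_and_hLst_of_ker_piLevelAut_eq_charOpenCore h37.toProp36Hypotheses.isCountable (ofCharCores_sameComponent h37.toProp36Hypotheses v₀ hVt hEt) T R ρ' (isArithCompatible_piPresentation_outerAction_of_branchPair_chart_of_finite (GaloisLevelData.ofCharCores h37.toProp36Hypotheses v₀ hVt hEt) h37.toProp36Hypotheses.isCountable (ofCharCores_exists_level_splits_component h37.toProp36Hypotheses v₀ hVt hEt) h37.toProp36Hypotheses.isConnected (ofCharCores_splits_self h37.toProp36Hypotheses v₀ hVt hEt) (ofCharCores_isFinite h37.toProp36Hypotheses v₀ hVt hEt) (ofCharCores_hasNonemptyFibres h37.toProp36Hypotheses v₀ hVt hEt) T R ρ' baseAct h37 hG hV hBR) (fun k : ℕ => k) (GaloisLevelData.ofCharCores_ker_piLevelAut_eq_charOpenCore h37.toProp36Hypotheses v₀ hVt hEt)).1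
        ((GaloisLevelData.ofCharCores h37.toProp36Hypotheses v₀ hVt hEt).ker_projAut_anti h37.toProp36Hypotheses.isCountable) ((GaloisLevelData.ofCharCores h37.toProp36Hypotheses v₀ hVt hEt).isOpen_ker_projAut h37.toProp36Hypotheses.isCountable) (fun _ hU => (GaloisLevelData.ofCharCores h37.toProp36Hypotheses v₀ hVt hEt).exists_ker_projAut_subset h37.toProp36Hypotheses.isCountable hU) ((GaloisLevelData.ofCharCores h37.toProp36Hypotheses v₀ hVt hEt).hK1'_chart_of_eventually_congruenceContinuous_of_hself h37.toProp36Hypotheses.isCountable (ofCharCores_exists_level_splits_component h37.toProp36Hypotheses v₀ hVt hEt) h37.toProp36Hypotheses.isConnected (ofCharCores_splits_self h37.toProp36Hypotheses v₀ hVt hEt) (ofCharCores_isFinite h37.toProp36Hypotheses v₀ hVt hEt) (ofCharCores_hasNonemptyFibres h37.toProp36Hypotheses v₀ hVt hEt) (ofCharCores_sameComponent h37.toProp36Hypotheses v₀ hVt hEt) ρ' baseAct T R (isArithCompatible_piPresentation_outerAction_of_branchPair_chart_of_finite (GaloisLevelData.ofCharCores h37.toProp36Hypotheses v₀ hVt hEt)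 h37.toProp36Hypotheses.isCountable (ofCharCores_exists_level_splits_component h37.toProp36Hypotheses v₀ hVt hEt) h37.toProp36Hypotheses.isConnected (ofCharCores_splits_self h37.toProp36Hypotheses v₀ hVt hEt) (ofCharCores_isFinite h37.toProp36Hypotheses v₀ hVt hEt) (ofCharCores_hasNonemptyFibres h37.toProp36Hypotheses v₀ hVt hEt) T R ρ' baseAct h37 hG hV hBR) (fun k : ℕ => k) (GaloisLevelData.ofCharCores_ker_piLevelAut_eq_charOpenCore h37.toProp36Hypotheses v₀ hVt hEt) hG n₀ hself hCC))
    (noSwitchBase : NoBranchSwitching 𝒢.graph.edgeOf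
      (fun (a : PA) (b : 𝒢.graph.Branch) => (baseAct a).hom.branchMap b))
    -- the two tower inputs of abc-iut-w4-d085's "hUρ" (ArithLevelKernelInner, Corollary D): RESIDUAL FINITENESS
    -- of `π₁^temp(𝒢)` along the finite levels ([SemiAnbd] Prop 3.6 (iii)) and the compact-subgroup test (estrangement)
    (hR : ∀ g : ((GaloisLevelData.ofCharCores h37.toProp36Hypotheses v₀ hVt hEt).chart h37.toProp36Hypotheses.isCountable (ofCharCores_exists_level_splits_component h37.toProp36Hypotheses v₀ hVt hEt) h37.toProp36Hypotheses.isConnected (ofCharCores_splits_self h37.toProp36Hypotheses v₀ hVt hEt) (ofCharCores_isFinite h37.toProp36Hypotheses v₀ hVt hEt) (ofCharCores_hasNonemptyFibres h37.toProp36Hypotheses v₀ hVt hEt)).G, (∀ n, g ∈ ((GaloisLevelData.ofCharCores h37.toProp36Hypotheses v₀ hVt hEt).piLevelAut h37.toProp36Hypotheses.isCountable (ofCharCores_sameComponent h37.toProp36Hypotheses v₀ hVt hEt) n).ker) → g = 1)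
    (hnobp : ∀ C : Subgroup ((GaloisLevelData.ofCharCores h37.toProp36Hypotheses v₀ hVt hEt).chart h37.toProp36Hypotheses.isCountable (ofCharCores_exists_level_splits_component h37.toProp36Hypotheses v₀ hVt hEt) h37.toProp36Hypotheses.isConnected (ofCharCores_splits_self h37.toProp36Hypotheses v₀ hVt hEt) (ofCharCores_isFinite h37.toProp36Hypotheses v₀ hVt hEt) (ofCharCores_hasNonemptyFibres h37.toProp36Hypotheses v₀ hVt hEt)).G, IsCompact (C : Set ((GaloisLevelData.ofCharCores h37.toProp36Hypotheses v₀ hVt hEt).chart h37.toProp36Hypotheses.isCountable (ofCharCores_exists_level_splits_component h37.toProp36Hypotheses v₀ hVt hEt) h37.toProp36Hypotheses.isConnected (ofCharCores_splits_self h37.toProp36Hypotheses v₀ hVt hEt) (ofCharCores_isFinite h37.toProp36Hypotheses v₀ hVt hEt) (ofCharCores_hasNonemptyFibres h37.toProp36Hypotheses v₀ hVt hEt)).G) →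
      (∀ n (t : C), ((GaloisLevelData.ofCharCores h37.toProp36Hypotheses v₀ hVt hEt).piPresentation h37.toProp36Hypotheses.isCountable T R).deckAct ((GaloisLevelData.ofCharCores h37.toProp36Hypotheses v₀ hVt hEt).piLevelAut h37.toProp36Hypotheses.isCountable (ofCharCores_sameComponent h37.toProp36Hypotheses v₀ hVt hEt) n).ker (t : ((GaloisLevelData.ofCharCores h37.toProp36Hypotheses v₀ hVt hEt).chart h37.toProp36Hypotheses.isCountable (ofCharCores_exists_level_splits_component h37.toProp36Hypotheses v₀ hVt hEt) h37.toProp36Hypotheses.isConnected (ofCharCores_splits_self h37.toProp36Hypotheses v₀ hVt hEt) (ofCharCores_isFinite h37.toProp36Hypotheses v₀ hVt hEt) (ofCharCores_hasNonemptyFibres h37.toProp36Hypotheses v₀ hVt hEt)).G) = 1) → C = ⊥)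
    (hest : IsTotallyArithEstranged (decompositionDataOfChart Rc (toOuterSemidirectProduct ρ')) (outerSemidirectProductSnd ρ')) (hbot : ¬ IsArithAmple (outerSemidirectProductSnd ρ') ⊥) :
    ArithMaximalCompactStatementI (decompositionDataOfChart Rc (toOuterSemidirectProduct ρ')) (outerSemidirectProductSnd ρ') ∧
      ArithMaximalCompactStatementII (decompositionDataOfChart Rc (toOuterSemidirectProduct ρ')) (outerSemidirectProductSnd ρ') :=
  arithMaximalCompactStatement_outerAction_piPresentation_chart_of_designData_of_congruenceContinuous (GaloisLevelData.ofCharCores h37.toProp36Hypotheses v₀ hVt hEt)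
    h37.toProp36Hypotheses.isCountable (ofCharCores_exists_level_splits_component h37.toProp36Hypotheses v₀ hVt hEt) h37.toProp36Hypotheses.isConnected
    (ofCharCores_splits_self h37.toProp36Hypotheses v₀ hVt hEt) (ofCharCores_isFinite h37.toProp36Hypotheses v₀ hVt hEt) (ofCharCores_hasNonemptyFibres h37.toProp36Hypotheses v₀ hVt hEt)
    (ofCharCores_sameComponent h37.toProp36Hypotheses v₀ hVt hEt) h37 hG ρ' baseAct T R Rc hRcV hRcB hV hE hopen hBR w₀ (fun k : ℕ => k) (GaloisLevelData.ofCharCores_ker_piLevelAut_eq_charOpenCore h37.toProp36Hypotheses v₀ hVt hEt)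
    (faithfulV_ofCharCores v₀ h37 hVt hEt) n₀ hself hCC hinst noSwitchBase hR hnobp hest hbot

end ProfiniteSemiGraph

end Literature.AnabelianGeometry.SemiGraphs
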